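import Mathlib
import HarnessLib
import Summits.NavierStokesRegularity.NavierStokesRegularity.Theorems.TypeIQuarterGateScarEnvelopeTypeIForcedTsaiAlgCert
import Summits.NavierStokesRegularity.NavierStokesRegularity.Theorems.TypeIQuarterGateScarEnvelopeTypeIForcedTsaiFieldCalculus

/-!
# ARM B lane E-exact, Type-I-tail class — REAL SEMANTICS of the symbolic objects of `…ForcedTsaiAlgCert`
  (`kbase`, `vpow`, `Mono5.eval`, `Poly5.eval`, `evalVec5`; value lemmas for `add/scale/sub/mulVar/mul/
  combine/norm/nmul`, the normal form `nf`, `tPow/expandT`, the two weights; positivity/continuity; the auxiliary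
  definitions `evalOpt`, `subF`, `μP`, `Mono5.momentR`, `AlgRow.tauR`, `AlgRow.field` used downstream)

Foundation layer of the soundness theorem `AlgRow.check = true → ForcedTsaiModulusLE M δ`: this file fixes
WHAT the 5-monomial lists MEAN as real functions on `ℝ³` — `c·y₁^a₁y₂^a₂y₃^a₃·(|y|²)^k·(1+|y|²/τ²)^{−h/2}` —
and proves that every list operation of the checker is value-preserving (the normal-form rewrites
`y₃² → t − y₁² − y₂²`, `t·v² → τ²(1−v²)` need `τ ≠ 0`).  Nothing here bears on NS regularity.
-/

noncomputable section

set_option linter.dupNamespace false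

namespace Summit.NavierStokesRegularity.NavierStokesRegularity.Cruxes.ScarEnvelopeTypeI.ForcedTsai

open MeasureTheory Set Metric Real
open scoped RealInnerProductSpace ContDiff
open Literature.Analysis.FluidPDE

/-! ## Definitions -/

/-- The kernel base `1 + |y|²/τ²` (`≥ 1`). -/
def kbase (τ : ℝ) (y : E3) : ℝ := 1 + ‖y‖ ^ 2 / τ ^ 2

/-- `v^h = (1 + |y|²/τ²)^{−h/2}`. -/
def vpow (τ : ℝ) (h : ℕ) (y : E3) : ℝ := kbase τ y ^ (-(h : ℝ) / 2)

/-- Value of a 5-monomial at `y ∈ ℝ³`. -/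
def Mono5.eval (τ : ℝ) (m : Mono5) (y : E3) : ℝ :=
  (m.c : ℝ) * y 0 ^ m.e1 * y 1 ^ m.e2 * y 2 ^ m.e3 * (‖y‖ ^ 2) ^ m.et * vpow τ m.eh y

/-- Value of a sparse 5-polynomial (the SUM of its monomials). -/
def Poly5.eval (τ : ℝ) (P : Poly5) (y : E3) : ℝ := (P.map fun m => Mono5.eval τ m y).sum

/-- Value of a symbolic vector field. -/
def evalVec5 (τ : ℝ) (V : Fin 3 → Poly5) (y : E3) : E3 := WithLp.toLp 2 fun i => Poly5.eval τ (V i) y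

/-! ## The kernel: positivity, algebra, continuity -/

/-- `kbase ≥ 1`. -/
theorem one_le_kbase (τ : ℝ) (y : E3) : 1 ≤ kbase τ y := by
  unfold kbase; have : 0 ≤ ‖y‖ ^ 2 / τ ^ 2 := by positivity
  linarith

/-- `kbase > 0`. -/
theorem kbase_pos (τ : ℝ) (y : E3) : 0 < kbase τ y := lt_of_lt_of_le one_pos (one_le_kbase τ y)

/-- `v^h > 0`. -/
theorem vpow_pos (τ : ℝ) (h : ℕ) (y : E3) : 0 < vpow τ h y := Real.rpow_pos_of_pos (kbase_pos τ y) _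

/-- `v^h ≤ 1`. -/
theorem vpow_le_one (τ : ℝ) (h : ℕ) (y : E3) : vpow τ h y ≤ 1 := by
  unfold vpow
  exact Real.rpow_le_one_of_one_le_of_nonpos (one_le_kbase τ y)
    (by have h0 : (0:ℝ) ≤ (h : ℝ) := Nat.cast_nonneg h; linarith)

/-- `v^0 = 1`. -/
@[simp] theorem vpow_zero (τ : ℝ) (y : E3) : vpow τ 0 y = 1 := by simp [vpow]

/-- `v^{h+h'} = v^h · v^{h'}`. -/
theorem vpow_add (τ : ℝ) (h h' : ℕ) (y : E3) : vpow τ (h + h') y = vpow τ h y * vpow τ h' y := by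
  unfold vpow
  rw [← Real.rpow_add (kbase_pos τ y)]
  congr 1; push_cast; ring

/-- `v² = (1 + |y|²/τ²)⁻¹`. -/
theorem vpow_two (τ : ℝ) (y : E3) : vpow τ 2 y = (kbase τ y)⁻¹ := by
  unfold vpow
  rw [show (-((2 : ℕ) : ℝ) / 2) = -1 by norm_num, Real.rpow_neg_one]

/-- The rewrite `t·v² = τ²(1 − v²)` (needs `τ ≠ 0`). -/
theorem norm_sq_mul_vpow_two {τ : ℝ} (hτ : τ ≠ 0) (y : E3) :
    ‖y‖ ^ 2 * vpow τ 2 y = τ ^ 2 * (1 - vpow τ 2 y) := by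
  rw [vpow_two]
  have hk := kbase_pos τ y
  have hτ2 : τ ^ 2 ≠ 0 := pow_ne_zero 2 hτ
  unfold kbase at hk ⊢
  field_simp
  ring

/-- The rewrite `y₃² = t − y₁² − y₂²`. -/
theorem coord_two_sq (y : E3) : y 2 ^ 2 = ‖y‖ ^ 2 - y 0 ^ 2 - y 1 ^ 2 := by
  rw [EuclideanSpace.real_norm_sq_eq, Fin.sum_univ_three]; ring

/-- `kbase` is continuous. -/
theorem continuous_kbase (τ : ℝ) : Continuous (kbase τ) := by
  unfold kbase; exact continuous_const.add ((continuous_norm.pow 2).div_const _)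

/-- `v^h` is continuous. -/
theorem continuous_vpow (τ : ℝ) (h : ℕ) : Continuous (vpow τ h) := by
  unfold vpow
  exact (continuous_kbase τ).rpow_const fun y => Or.inl (kbase_pos τ y).ne'

/-- The `y`-part of a 5-monomial as an old-style monomial. -/
def Mono5.yMono (m : Mono5) : Mono := ⟨m.e1, m.e2, m.e3, m.c⟩

/-- A 5-monomial is `(y-monomial) · t^et · v^eh`. -/
theorem Mono5.eval_eq (τ : ℝ) (m : Mono5) (y : E3) :
    Mono5.eval τ m y = Mono.eval m.yMono y * (QPoly.eval tPoly y) ^ m.et * vpow τ m.eh y := by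
  rw [Mono5.eval, Mono.eval, eval_tPoly]; rfl

/-! ## Value lemmas for the list algebra -/

/-- The empty list is `0`. -/
@[simp] theorem Poly5.eval_nil (τ : ℝ) (y : E3) : Poly5.eval τ [] y = 0 := by simp [Poly5.eval]

/-- A cons adds the head monomial. -/
@[simp] theorem Poly5.eval_cons (τ : ℝ) (m : Mono5) (P : Poly5) (y : E3) :
    Poly5.eval τ (m :: P) y = Mono5.eval τ m y + Poly5.eval τ P y := by simp [Poly5.eval]

/-- Append adds. -/
@[simp] theorem Poly5.eval_append (τ : ℝ) (P Q : Poly5) (y : E3) :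
    Poly5.eval τ (P ++ Q) y = Poly5.eval τ P y + Poly5.eval τ Q y := by
  simp [Poly5.eval, List.sum_append]

/-- `add` is `+`. -/
@[simp] theorem Poly5.eval_add (τ : ℝ) (P Q : Poly5) (y : E3) :
    Poly5.eval τ (Poly5.add P Q) y = Poly5.eval τ P y + Poly5.eval τ Q y := by
  simp [Poly5.add]

/-- Changing the coefficient scales the value. -/
theorem Mono5.eval_coeff (τ : ℝ) (m : Mono5) (c : ℚ) (y : E3) :
    Mono5.eval τ { m with c := c } y * (m.c : ℝ) = (c : ℝ) * Mono5.eval τ m y := by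
  simp only [Mono5.eval]; ring

/-- `scale c` is `c • ·`. -/
@[simp] theorem Poly5.eval_scale (τ : ℝ) (c : ℚ) (P : Poly5) (y : E3) :
    Poly5.eval τ (Poly5.scale c P) y = (c : ℝ) * Poly5.eval τ P y := by
  induction P with
  | nil => simp [Poly5.scale]
  | cons m P ih =>
    simp only [Poly5.scale, List.map_cons, Poly5.eval_cons] at ih ⊢
    rw [ih]; simp only [Mono5.eval]; push_cast; ring

/-- `sub` is `−`. -/
@[simp] theorem Poly5.eval_sub (τ : ℝ) (P Q : Poly5) (y : E3) :
    Poly5.eval τ (Poly5.sub P Q) y = Poly5.eval τ P y - Poly5.eval τ Q y := by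
  simp [Poly5.sub]; ring

/-- `Mono5.mulVar j` multiplies the value by `y_j`. -/
theorem Mono5.eval_mulVar (τ : ℝ) (j : Fin 3) (m : Mono5) (y : E3) :
    Mono5.eval τ (Mono5.mulVar j m) y = y j * Mono5.eval τ m y := by
  fin_cases j <;> simp [Mono5.mulVar, Mono5.eval, pow_succ] <;> ring

/-- `mulVar j` multiplies the value by `y_j`. -/
@[simp] theorem Poly5.eval_mulVar (τ : ℝ) (j : Fin 3) (P : Poly5) (y : E3) :
    Poly5.eval τ (Poly5.mulVar j P) y = y j * Poly5.eval τ P y := by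
  induction P with
  | nil => simp [Poly5.mulVar]
  | cons m P ih =>
    simp only [Poly5.mulVar, List.map_cons, Poly5.eval_cons] at ih ⊢
    rw [ih, Mono5.eval_mulVar]; ring

/-- `Mono5.mul` multiplies values. -/
theorem Mono5.eval_mul (τ : ℝ) (m m' : Mono5) (y : E3) :
    Mono5.eval τ (Mono5.mul m m') y = Mono5.eval τ m y * Mono5.eval τ m' y := by
  simp only [Mono5.mul, Mono5.eval, pow_add, vpow_add]; push_cast; ring

/-- Mapping `Mono5.mul m` over a list multiplies its value by the value of `m`. -/
theorem Poly5.eval_map_mul (τ : ℝ) (m : Mono5) (Q : Poly5) (y : E3) :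
    Poly5.eval τ (Q.map (Mono5.mul m)) y = Mono5.eval τ m y * Poly5.eval τ Q y := by
  induction Q with
  | nil => simp
  | cons m' Q ih => simp only [List.map_cons, Poly5.eval_cons] at ih ⊢; rw [ih, Mono5.eval_mul]; ring

/-- `mul` multiplies values. -/
@[simp] theorem Poly5.eval_mul (τ : ℝ) (P Q : Poly5) (y : E3) :
    Poly5.eval τ (Poly5.mul P Q) y = Poly5.eval τ P y * Poly5.eval τ Q y := by
  induction P with
  | nil => simp [Poly5.mul]
  | cons m P ih =>
    simp only [Poly5.mul, List.flatMap_cons] at ih ⊢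
    rw [Poly5.eval_append, ih, Poly5.eval_cons, Poly5.eval_map_mul]
    ring

/-- Monomials with equal keys add their coefficients. -/
theorem Mono5.eval_key_eq (τ : ℝ) {m m' : Mono5} (h : m.key = m'.key) (y : E3) :
    Mono5.eval τ { m with c := m.c + m'.c } y = Mono5.eval τ m y + Mono5.eval τ m' y := by
  simp only [Mono5.key, Prod.mk.injEq] at h
  obtain ⟨h1, h2, h3, h4, h5⟩ := h
  simp only [Mono5.eval, h1, h2, h3, h4, h5]; push_cast; ring

/-- `combine` preserves the value. -/
theorem Poly5.eval_combine (τ : ℝ) (P : Poly5) (y : E3) : Poly5.eval τ (Poly5.combine P) y = Poly5.eval τ P y := by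
  induction P using Poly5.combine.induct with
  | case1 => simp [Poly5.combine]
  | case2 m hc => simp [Poly5.combine, hc, Mono5.eval]
  | case3 m hc => simp [Poly5.combine, hc]
  | case4 m m' rest hkey ih =>
    rw [Poly5.combine, if_pos hkey, ih, Poly5.eval_cons, Poly5.eval_cons, Poly5.eval_cons,
      Mono5.eval_key_eq τ hkey]
    ring
  | case5 m m' rest hkey hc ih =>
    rw [Poly5.combine, if_neg hkey, if_pos hc, ih, Poly5.eval_cons, Poly5.eval_cons]
    simp [Mono5.eval, hc]
  | case6 m m' rest hkey hc ih =>
    rw [Poly5.combine, if_neg hkey, if_neg hc, Poly5.eval_cons, Poly5.eval_cons, ih, Poly5.eval_cons]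

/-- A permutation of the monomial list has the same value. -/
theorem Poly5.eval_perm (τ : ℝ) {P Q : Poly5} (h : P.Perm Q) (y : E3) : Poly5.eval τ P y = Poly5.eval τ Q y := by
  unfold Poly5.eval; exact (h.map _).sum_eq

/-- `norm` preserves the value. -/
@[simp] theorem Poly5.eval_norm (τ : ℝ) (P : Poly5) (y : E3) : Poly5.eval τ (Poly5.norm P) y = Poly5.eval τ P y := by
  rw [Poly5.norm, Poly5.eval_combine, Poly5.eval_perm τ (List.mergeSort_perm P Poly5.keyLE)]

/-- `nmul` multiplies values. -/
@[simp] theorem Poly5.eval_nmul (τ : ℝ) (P Q : Poly5) (y : E3) :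
    Poly5.eval τ (Poly5.nmul P Q) y = Poly5.eval τ P y * Poly5.eval τ Q y := by
  simp [Poly5.nmul]

/-- A `flatMap` evaluates to the sum of the values of the pieces. -/
theorem Poly5.eval_flatMap (τ : ℝ) (P : Poly5) (f : Mono5 → Poly5) (y : E3) :
    Poly5.eval τ (P.flatMap f) y = (P.map fun m => Poly5.eval τ (f m) y).sum := by
  induction P with
  | nil => simp
  | cons m P ih => rw [List.flatMap_cons, Poly5.eval_append, ih, List.map_cons, List.sum_cons]

/-! ## Continuity -/

/-- 5-monomials are continuous. -/
theorem Mono5.continuous_eval (τ : ℝ) (m : Mono5) : Continuous fun y : E3 => Mono5.eval τ m y := by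
  have h0 : Continuous fun y : E3 => y 0 := PiLp.continuous_apply 2 _ 0
  have h1 : Continuous fun y : E3 => y 1 := PiLp.continuous_apply 2 _ 1
  have h2 : Continuous fun y : E3 => y 2 := PiLp.continuous_apply 2 _ 2
  unfold Mono5.eval
  exact ((((continuous_const.mul (h0.pow _)).mul (h1.pow _)).mul (h2.pow _)).mul
    ((continuous_norm.pow 2).pow _)).mul (continuous_vpow τ _)

/-- Sparse 5-polynomials are continuous. -/
theorem Poly5.continuous_eval (τ : ℝ) (P : Poly5) : Continuous fun y : E3 => Poly5.eval τ P y := by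
  induction P with
  | nil => simpa using continuous_const
  | cons m P ih =>
    have : (fun y : E3 => Poly5.eval τ (m :: P) y) = fun y => Mono5.eval τ m y + Poly5.eval τ P y := by
      funext y; simp
    rw [this]; exact (Mono5.continuous_eval τ m).add ih

/-- Symbolic vector fields are continuous. -/
theorem continuous_evalVec5 (τ : ℝ) (V : Fin 3 → Poly5) : Continuous (evalVec5 τ V) :=
  (PiLp.continuous_toLp 2 _).comp (continuous_pi fun i => Poly5.continuous_eval τ (V i))

/-- Components of a symbolic vector field. -/
@[simp] theorem evalVec5_apply (τ : ℝ) (V : Fin 3 → Poly5) (y : E3) (i : Fin 3) :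
    evalVec5 τ V y i = Poly5.eval τ (V i) y := by
  simp [evalVec5]

/-! ## Auxiliary definitions used by the calculus / moments / soundness files -/

/-- Value of an optional monomial (`none ↦ 0`). -/
def evalOpt (τ : ℝ) (o : Option Mono5) (y : E3) : ℝ := match o with | none => 0 | some m => Mono5.eval τ m y

/-- The Gamma-subordinated integrand `F(y,s) = c y^a · Γ(r)⁻¹ s^{r−1} e^{−s} · e^{−(s/τ²)|y|²}` on `ℝ³ × ℝ`
(its `s`-integral over `(0,∞)` is `c y^a (1+|y|²/τ²)^{−r}`). -/
def subF (τ : ℝ) (m : Mono) (r : ℝ) (p : E3 × ℝ) : ℝ :=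
  Mono.eval m p.1 * ((Real.Gamma r)⁻¹ * (p.2 ^ (r - 1) * Real.exp (-p.2))) * gauss (p.2 / τ ^ 2) p.1

/-- The product measure `volume × volume|_{(0,∞)}` on `ℝ³ × ℝ`. -/
def μP : Measure (E3 × ℝ) := (volume : Measure E3).prod ((volume : Measure ℝ).restrict (Ioi 0))

/-- The real value of the checker's `momentQ` times the right power of `π` (`π` for odd `h`, `π²` for even). -/
def Mono5.momentR (τ : ℚ) (m : Mono5) : ℝ :=
  (m.momentQ τ : ℝ) * (if m.eh % 2 = 1 then π else π ^ 2)

namespace AlgRow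

/-- The scale of a row as a real number. -/
def tauR (r : AlgRow) : ℝ := (r.tau : ℝ)

/-- `τ2 = τ²` across the cast. -/
theorem cast_tau2 (r : AlgRow) : ((r.tau2 : ℚ) : ℝ) = r.tauR ^ 2 := by
  unfold tau2 tauR; push_cast; ring

/-- **The witness field** of a row: `U = evalVec5 τ u`, `u = curl5 Ψ` (`= curl (evalVec5 τ Ψ)`, proved in
`…AlgSound`). -/
def field (r : AlgRow) : E3 → E3 := evalVec5 r.tauR r.u

end AlgRow

end Summit.NavierStokesRegularity.NavierStokesRegularity.Cruxes.ScarEnvelopeTypeI.ForcedTsai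

end
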